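import Summits.ResolutionOfSingularities.ResolutionOfSingularities.Theorems.FrobeniusLadderFRationalResolutionEveryPointLogRegular
import Literature.AlgebraicGeometry.Resolution.TameQuotientSingularitiesResolutionProofs
import Mathlib.AlgebraicGeometry.Morphisms.Etale
import HarnessLib

/-!
# Crux `FrobeniusLadder.FRationalResolution` (stmt-ResolutionOfSingularities-15317), line `redirect` —
# under the hypothesis of `stub_diagonalizableQuotientResolution` VERBATIM, every point of `X` is the
# image of a point of a quotient chart `Spec S₀` lying under a prime `𝔔` of `S` at which the
# intermediate quotient `Spec S^{(B_𝔔)}` is KATO-LOG-REGULAR (packaging of p816298 in the stub's frame)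

For the next seat: this is where the landed L3/L6 programme meets the registered stub. Given the
stub's `hq` (étale charts `Spec S₀ → X` from regular finite-type `S` graded by a finite abelian
group `A`), every `x ∈ X` has a chart through it, a prime `𝔔` of `S` over the corresponding point of
`Spec S₀` (`Spec S → Spec S₀` is surjective, `DiagonalizableQuotient.specMap_gradeZero_surjective`),
and at `𝔔` the conclusion of `EveryPointLogRegular.exists_isLogRegularAt_intermediate`. What remains
to the stub is listed there (torsor descent `S^{(B_𝔔)} ← S₀`, chart normalisation, chart
compatibility, then the tree's proved Nizioł resolution).

* `exists_chart_prime_isLogRegularAt_of_hq` — the statement above.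

Honest label: bookkeeping (no stub closed). No definitions, no named facts, no sorry.
[cite: Kato1994, Def. (2.1)] [folklore; cite: SGA3, Exp. VIII §4–5]
-/

noncomputable section

-- single-problem summit: the doubled namespace component is forced
set_option linter.dupNamespace false

open CategoryTheory AlgebraicGeometry
open Literature.AlgebraicGeometry.Resolution
open Literature.AlgebraicGeometry.Resolution.DiagonalizableQuotient

namespace Summit.ResolutionOfSingularities.ResolutionOfSingularities.Theorems.FRationalResolution.StubPointsLogRegular

/-- **Every point of `X` sits under a Kato-log-regular point of an intermediate quotient chart**,
under the hypothesis `hq` of `stub_diagonalizableQuotientResolution` verbatim (any field `k`): for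
`x ∈ X` there are a chart `φ : Spec S₀ → X` of `hq` with `x = φ v`, a prime `𝔔` of `S` contracting to
`v`, and — with `B = B_𝔔` and the `A/B`-coarsened grading `S'` (`S'_0 = S^{(B)} ⊇ S₀`) — homogeneous
`x₁,…,x_n ∈ 𝔔`, `n = dim S_𝔔`, whose monomial chart makes `Spec S^{(B)}` satisfy Kato's (2.1) at
`𝔔 ∩ S^{(B)}`. [cite: Kato1994, Def. (2.1)] -/
theorem exists_chart_prime_isLogRegularAt_of_hq (k : Type) [Field k] (X : Scheme.{0})
    (g : X ⟶ Spec (.of k))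
    (hq : ∀ x : X, ∃ (A : Type) (_ : AddCommGroup A) (_ : Finite A) (_ : DecidableEq A)
        (S : Type) (_ : CommRing S) (_ : Algebra k S) (𝒮 : A → Submodule k S)
        (_ : GradedAlgebra 𝒮), Algebra.FiniteType k S ∧ IsRegularRing S ∧
        ∃ φ : Spec (.of (𝒮 0)) ⟶ X, Etale φ ∧ x ∈ Set.range φ ∧
          φ ≫ g = Spec.map (CommRingCat.ofHom (algebraMap k (𝒮 0))))
    (x : X) :
    ∃ (A : Type) (_ : AddCommGroup A) (_ : Finite A) (_ : DecidableEq A)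
      (S : Type) (_ : CommRing S) (_ : Algebra k S) (𝒮 : A → Submodule k S) (_ : GradedAlgebra 𝒮)
      (_ : Algebra.FiniteType k S) (_ : IsRegularRing S)
      (φ : Spec (.of (𝒮 0)) ⟶ X) (_ : Etale φ) (v : Spec (.of (𝒮 0))) (_ : φ v = x)
      (𝔔 : Ideal S) (_ : 𝔔.IsPrime) (_ : 𝔔.comap (algebraMap (𝒮 0) S) = v.asIdeal)
      (B : AddSubgroup A) (_ : DecidableEq (A ⧸ B)) (𝒮' : A ⧸ B → Submodule k S)
      (_ : GradedAlgebra 𝒮'),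
      (∀ a : A, a ∈ B ↔ ∃ s ∈ 𝒮 a, s ∉ 𝔔) ∧
      (∀ c, 𝒮' c = ⨆ a ∈ {a : A | (a : A ⧸ B) = c}, 𝒮 a) ∧ (∀ a, 𝒮 a ≤ 𝒮' (a : A ⧸ B)) ∧
      ∃ (n : ℕ) (y : Fin n → S) (a : Fin n → A ⧸ B),
        (∀ i, y i ∈ 𝔔 ∧ y i ∈ 𝒮' (a i)) ∧
        (n : WithBot ℕ∞) = ringKrullDim (Localization.AtPrime 𝔔) ∧
        ∃ ψ : Multiplicative ↥(AddSubmonoid.nonneg (Fin n → ℤ) ⊓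
            AddMonoidHom.mker (Fintype.linearCombination ℤ a).toAddMonoidHom) →* 𝒮' 0,
          (∀ p, ((ψ (Multiplicative.ofAdd p) : 𝒮' 0) : S) =
            ∏ i, y i ^ ((p : Fin n → ℤ) i).toNat) ∧
          LogChart.IsLogRegularAt _ ψ (𝔔.comap (algebraMap (𝒮' 0) S)) := by
  classical
  obtain ⟨A, _, _, _, S, _, _, 𝒮, _, hft, hreg, φ, hφ, ⟨v, hv⟩, -⟩ := hq x
  haveI := hft
  haveI := hreg
  have hA : AddMonoid.IsTorsion A := fun a => isOfFinAddOrder_of_finite a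
  -- a prime of `S` over `v`
  obtain ⟨w, hw⟩ := comap_algebraMap_gradeZero_surjective 𝒮 hA v
  let 𝔔 : Ideal S := w.asIdeal
  haveI : 𝔔.IsPrime := w.isPrime
  have h𝔔 : 𝔔.comap (algebraMap (𝒮 0) S) = v.asIdeal := by
    have h := congrArg PrimeSpectrum.asIdeal hw
    rwa [PrimeSpectrum.comap_asIdeal] at h
  obtain ⟨B, instB, 𝒮', inst', hB, h𝒮', hle, n, y, a, hya, hn, ψ, hψ, hlog⟩ :=
    EveryPointLogRegular.exists_isLogRegularAt_intermediate 𝒮 hA 𝔔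
  exact ⟨A, _, ‹_›, _, S, _, _, 𝒮, ‹_›, hft, hreg, φ, hφ, v, hv, 𝔔, ‹_›, h𝔔, B, instB, 𝒮', inst',
    hB, h𝒮', hle, n, y, a, hya, hn, ψ, hψ, hlog⟩

end Summit.ResolutionOfSingularities.ResolutionOfSingularities.Theorems.FRationalResolution.StubPointsLogRegular

end
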